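import Summits.CriticalPhenomena.CardyFormulaZ2.Theorems.HalfPlaneMarkDensityLaw.Negative.MarkEvents
import Literature.Probability.Percolation.RSWLemma
import Literature.Probability.Percolation.InequalitiesProofs

/-!
# `HalfPlaneMarkDensityLaw` (crux stmt-CriticalPhenomena-5661): the order hypotheses are
# load-bearing, and the boundary case `x = c` fails for a percolation reason (negative-side support, 3/4)

Support file of the crux disprover (cdisprove seat, 2026-08-16); `sorry`-free, standard axioms.

* §4 JUNK WITNESSES: the crux with one order hypothesis dropped is false —
  `law_false_without_hab` (`b < a`: empty arc, limit `0 ≠ density ≠ 0`, as Mathlib's `rpow` of a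
  negative base is `|·|^{1/3} cos(π/3)`), `law_false_without_hbc` (`c < b`: arcs overlap, event empty),
  `law_false_without_hcx` (`x ∈ [a,b]`: event sure, `n·1 → ∞`).
* §7 THE CASE `x = c` IS SUBSTANTIVE: there `E_n = {A_n ↔ (⌊cn⌋,0)}` and the RHS is the junk value
  `0`, but `n·P[A_n ↔ (2n,0) in ℤ×ℕ] ≥ c_RSW/8` for all `n ≥ 1` (`first_site_heavy`: square crossing
  `1/2`, RSW `4:1`, Harris–FKG, translation invariance, the rectangle-crossing Jordan lemma — all PROVED
  tree facts — and the union-bound one-arm estimate `armEvent_prob_ge : P ≥ 1/(2(n+1))`); hence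
  `not_lawAt_x_eq_c` and `law_false_with_hcx_le` (`c < x` cannot be weakened to `c ≤ x`).
  Conjecturally the first site has mass `≍ n^{−1/3}`, the lattice face of the density's `(x−c)^{−2/3}`
  singularity.
-/

noncomputable section

namespace Summit.CriticalPhenomena.CardyFormulaZ2.Theorems.HalfPlaneMarkDensityLaw.Negative

open Literature.Probability.Percolation Literature.Probability.LatticeModels
open Literature.Probability.RandomPlanarGeometry
open MeasureTheory Filter Set
open scoped ENNReal NNReal Topology
open Summit.CriticalPhenomena.CardyFormulaZ2.Theses.CardyBoundaryCoulombGas (HalfPlaneMarkDensityLaw)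

/-! ## §4 Load-bearing analysis of the order hypotheses (junk witnesses) -/

/-- The junk value shared by the first two witnesses: `density 1 0 2 3 = density 0 2 1 3 =
(cardyConst/3)·(−2)^{1/3}·6^{−2/3} ≠ 0` (Mathlib's `rpow` of a negative base carries `cos(π/3) = 1/2`). [folklore] -/
lemma junkDensity_ne_zero : cardyConst / 3 * (-2 : ℝ) ^ (1 / 3 : ℝ) * (6 : ℝ) ^ (-(2 / 3) : ℝ) ≠ 0 := by
  have h1 : (0 : ℝ) < cardyConst / 3 := by have := cardyConst_pos; positivity
  have h2 : (-2 : ℝ) ^ (1 / 3 : ℝ) ≠ 0 := by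
    rw [Real.rpow_def_of_neg (by norm_num : (-2 : ℝ) < 0)]
    have hc : Real.cos (1 / 3 * Real.pi) = 1 / 2 := by
      rw [show (1 / 3 : ℝ) * Real.pi = Real.pi / 3 by ring]; exact Real.cos_pi_div_three
    rw [hc]; positivity
  have h3 : (0 : ℝ) < (6 : ℝ) ^ (-(2 / 3) : ℝ) := Real.rpow_pos_of_pos (by norm_num) _
  exact mul_ne_zero (mul_ne_zero h1.ne' h2) h3.ne'

/-- WITNESS 1 (`b < a`): for `a = 1, b = 0, c = 2, x = 3` the arc `A_n` is empty once `n ≥ 1`, so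
`E_n = ∅`, `n·P(E_n) = 0 → 0`, whereas `density 1 0 2 3 ≠ 0`.  Hence `a < b` cannot be dropped
(as a junk guard: it is what makes `A_n` non-empty). [folklore] -/
theorem law_false_without_hab :
    ¬ ∀ a b c x : ℝ, b < c → c < x → Tendsto (lawSeq a b c x) atTop (𝓝 (density a b c x)) := by
  intro h
  have hlaw := h 1 0 2 3 (by norm_num) (by norm_num)
  have hev : ∀ n : ℕ, 1 ≤ n → markEvent 1 0 2 3 n = ∅ := by
    intro n hn
    have hA : arcA 1 0 n = ∅ := by
      ext v
      simp only [arcA, one_mul, Int.floor_natCast, zero_mul, Int.floor_zero, mem_setOf_eq,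
        mem_empty_iff_false, iff_false, not_and, not_le]
      intro _ h1
      have : (1 : ℤ) ≤ n := by exact_mod_cast hn
      omega
    simp [markEvent, hA, openCrossing_empty_left]
  have hzero : Tendsto (fun n : ℕ ↦ (n : ℝ) * μ.real (markEvent 1 0 2 3 n)) atTop (nhds 0) := by
    refine tendsto_const_nhds.congr' ?_
    filter_upwards [eventually_ge_atTop 1] with n hn
    simp [hev n hn]
  have heq : density 1 0 2 3 = 0 := tendsto_nhds_unique hlaw hzero
  refine junkDensity_ne_zero ?_
  have : density 1 0 2 3 = cardyConst / 3 * (-2 : ℝ) ^ (1 / 3 : ℝ) * (6 : ℝ) ^ (-(2 / 3) : ℝ) := by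
    norm_num [density]
  rw [← this, heq]

/-- WITNESS 2 (`c < b`): for `a = 0, b = 2, c = 1, x = 3` the arcs `A_n = [0,2n]` and `C_n = [n,3n)`
share the vertex `(n,0)` once `n ≥ 1`, so `{A_n ↔ C_n}` is sure, `E_n = ∅`, `n·P(E_n) → 0`, whereas
`density 0 2 1 3 ≠ 0`.  (At `b = c` exactly both sides vanish — `Δ = 0` — so `b < c` is needed only to
exclude `c < b`; `b ≤ c` would do.) [folklore] -/
theorem law_false_without_hbc :
    ¬ ∀ a b c x : ℝ, a < b → c < x → Tendsto (lawSeq a b c x) atTop (𝓝 (density a b c x)) := by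
  intro h
  have hlaw := h 0 2 1 3 (by norm_num) (by norm_num)
  have hev : ∀ n : ℕ, 1 ≤ n → markEvent 0 2 1 3 n = ∅ := by
    intro n hn
    have hn' : (1 : ℤ) ≤ n := by exact_mod_cast hn
    set v : Site 2 := ![(n : ℤ), 0] with hv
    have hS : v ∈ halfPlane := by simp [halfPlane, hv]
    have hA : v ∈ arcA 0 2 n := by
      simp only [arcA, zero_mul, Int.floor_zero, mem_setOf_eq, hv, Matrix.cons_val_one,
        Matrix.cons_val_zero, true_and]
      constructor
      · positivity
      · rw [show (2 : ℝ) * n = ((2 * n : ℕ) : ℝ) by push_cast; ring, Int.floor_natCast]; omega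
    have hC : v ∈ arcC 1 3 n := by
      simp only [arcC, one_mul, Int.floor_natCast, mem_setOf_eq, hv, Matrix.cons_val_one,
        Matrix.cons_val_zero, le_refl, true_and]
      rw [show (3 : ℝ) * n = ((3 * n : ℕ) : ℝ) by push_cast; ring, Int.floor_natCast]; omega
    simp [markEvent, openCrossing_eq_univ_of_mem hS hA hC]
  have hzero : Tendsto (fun n : ℕ ↦ (n : ℝ) * μ.real (markEvent 0 2 1 3 n)) atTop (nhds 0) := by
    refine tendsto_const_nhds.congr' ?_
    filter_upwards [eventually_ge_atTop 1] with n hn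
    simp [hev n hn]
  have heq : density 0 2 1 3 = 0 := tendsto_nhds_unique hlaw hzero
  refine junkDensity_ne_zero ?_
  have : density 0 2 1 3 = cardyConst / 3 * (-2 : ℝ) ^ (1 / 3 : ℝ) * (6 : ℝ) ^ (-(2 / 3) : ℝ) := by
    norm_num [density]
  rw [← this, heq]

/-- WITNESS 3 (`x < c`, indeed `x ∈ [a,b]`): for `a = 0, b = 2, c = 3, x = 1` the marked vertex
`(n,0)` lies IN the arc `A_n = [0,2n]`, so `{A_n ↔ (n,0)}` is sure, while `C_n = [3n, n) = ∅`; hence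
`E_n` is the sure event and `n·P(E_n) = n → ∞` converges to no real number.  So `c < x` cannot be
dropped.  (The boundary case `x = c` is substantive, see §6 `lawAt_x_eq_c_diverges`.) [folklore] -/
theorem law_false_without_hcx :
    ¬ ∀ a b c x : ℝ, a < b → b < c → Tendsto (lawSeq a b c x) atTop (𝓝 (density a b c x)) := by
  intro h
  have hlaw := h 0 2 3 1 (by norm_num) (by norm_num)
  have hev : ∀ n : ℕ, markEvent 0 2 3 1 n = univ := by
    intro n
    have hS : pt 1 n ∈ halfPlane := pt_mem_halfPlane 1 n
    have hA : pt 1 n ∈ arcA 0 2 n := by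
      simp only [arcA, zero_mul, Int.floor_zero, mem_setOf_eq, pt_one, pt_zero, one_mul,
        Int.floor_natCast, true_and]
      constructor
      · positivity
      · rw [show (2 : ℝ) * n = ((2 * n : ℕ) : ℝ) by push_cast; ring, Int.floor_natCast]; omega
    have hC : arcC 3 1 n = ∅ := by
      ext v
      simp only [arcC, one_mul, Int.floor_natCast, mem_setOf_eq, mem_empty_iff_false, iff_false,
        not_and, not_lt]
      intro _ h3
      rw [show (3 : ℝ) * n = ((3 * n : ℕ) : ℝ) by push_cast; ring, Int.floor_natCast] at h3; omega
    rw [markEvent, hC, openCrossing_empty_right, sdiff_empty,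
      openCrossing_eq_univ_of_mem hS hA (mem_singleton _)]
  have hid : Tendsto (fun n : ℕ ↦ (n : ℝ) * μ.real (markEvent 0 2 3 1 n)) atTop atTop := by
    have : (fun n : ℕ ↦ (n : ℝ) * μ.real (markEvent 0 2 3 1 n)) = fun n : ℕ ↦ (n : ℝ) := by
      funext n; simp [hev n]
    rw [this]; exact tendsto_natCast_atTop_atTop
  exact hid.not_tendsto (disjoint_nhds_atTop _).symm hlaw


/-! ## §7 The boundary case `x = c` is substantive: the first site is anomalously heavy (RSW)

At `x = c` the excluded arc `C_n` is empty and `E_n = {A_n ↔ (⌊cn⌋,0)}`; the crux's RHS is the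
junk value `0` (`0^{−2/3} = 0`), but `n·P[A_n ↔ (⌊cn⌋,0)]` is bounded BELOW (`first_site_heavy`,
instance `a,b,c = 0,1,2`: `≥ c_RSW/8`), so the law at `(0,1,2,2)` is false (`not_lawAt_x_eq_c`): the strict
inequality `c < x` is load-bearing for a percolation reason, not only as a junk guard.  Conjecturally
`P[A_n ↔ (⌊cn⌋,0)] ≍ n^{−1/3}` (half-plane one-arm exponent), i.e. the first site carries `n^{2/3}`
times the mass of a bulk site — the lattice face of the `(x−c)^{−2/3}` singularity; MC §8.
Ingredients (all PROVED tree facts): square crossing `≥ 1/2` (`crossingProb_half_succ_self_holds`),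
RSW for `4:1` rectangles (`rsw_lowerBound_holds`), Harris–FKG (`harris_fkg_holds`), translation
invariance (`real_openCrossing_shift`), the rectangle-crossing Jordan lemma
(`exists_mem_support_of_crossing`), plus the union-bound half-plane one-arm estimate
`P[(j,0) ↔ height n inside [j−n,j+n]×[0,n]] ≥ 1/(2(n+1))` (`armEvent_prob_ge`). -/

/-- The shift placing the `2n × n` box `[0,2n]×[0,n]` at `[j−n, j+n]×[0,n]`. [folklore] -/
def vshift (j : ℤ) (n : ℕ) : Site 2 := ![j - n, 0]

/-- First coordinate of `vshift`. [folklore] -/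
@[simp] lemma vshift_zero (j : ℤ) (n : ℕ) : vshift j n 0 = j - n := rfl

/-- Second coordinate of `vshift`. [folklore] -/
@[simp] lemma vshift_one (j : ℤ) (n : ℕ) : vshift j n 1 = 0 := rfl

/-- The half-plane one-arm event at the reference position: `(n,0)` is joined to the top side of
`[0,2n]×[0,n]` inside that box. [folklore] -/
def armEvent (n : ℕ) : Set (BondConfig (Site 2)) :=
  openCrossing ↑(rectangle (2 * n) n) {bpt n} ↑(topSide (2 * n) n)

/-- The same event around the boundary point `(j,0)`: box `[j−n,j+n]×[0,n]`. [folklore] -/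
def armEventAt (j : ℤ) (n : ℕ) : Set (BondConfig (Site 2)) :=
  openCrossing ((· + vshift j n) '' ↑(rectangle (2 * n) n)) ((· + vshift j n) '' {bpt n})
    ((· + vshift j n) '' ↑(topSide (2 * n) n))

/-- The shift moves the reference point `(n,0)` to `(j,0)`. [folklore] -/
lemma image_vshift_singleton (j : ℤ) (n : ℕ) : (· + vshift j n) '' {bpt n} = {bpt j} := by
  rw [image_singleton]
  congr 1
  funext i; fin_cases i <;> simp [bpt, vshift]

/-- Translation invariance: all `armEventAt j n` have the probability of `armEvent n`. [folklore] -/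
lemma measureReal_armEventAt (j : ℤ) (n : ℕ) : μ.real (armEventAt j n) = μ.real (armEvent n) :=
  real_openCrossing_shift half _ _ _ _

/-- A top–bottom crossing of the square `[0,n]²` starts at some `(j,0)`, `0 ≤ j ≤ n`, and is then an
arm from `(j,0)` to height `n` inside `[j−n,j+n]×[0,n]`. [folklore] -/
lemma tbCrossing_subset_iUnion (n : ℕ) :
    tbCrossing n n ⊆ ⋃ j ∈ Finset.range (n + 1), armEventAt (j : ℤ) n := by
  rintro ω ⟨b, hb, t, ht, hbt⟩
  simp only [Finset.mem_coe, bottomSide, topSide, Finset.mem_filter, mem_rectangle_iff] at hb ht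
  obtain ⟨j, hjn, hbj⟩ : ∃ j : ℕ, j ≤ n ∧ b 0 = j := ⟨(b 0).toNat, by omega, by omega⟩
  simp only [mem_iUnion, Finset.mem_range, exists_prop]
  refine ⟨j, by omega, b, ?_, t, ?_, openConnIn_mono ?_ _ _ hbt⟩
  · rw [image_vshift_singleton, mem_singleton_iff, site_eq_bpt_iff]; exact ⟨hb.2, hbj⟩
  · rw [mem_image_add_topSide]; simp only [vshift_zero, vshift_one]; push_cast; omega
  · intro z hz
    rw [Finset.mem_coe, mem_rectangle_iff] at hz
    rw [mem_image_add_rectangle]; simp only [vshift_zero, vshift_one]; push_cast; omega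

/-- **Half-plane one-arm lower bound by the union bound**: `P[armEvent n] ≥ 1/(2(n+1))`, since the
`n+1` translates cover the top–bottom crossing of the square, of probability `≥ 1/2`. [folklore] -/
theorem armEvent_prob_ge (n : ℕ) : 1 / (2 * ((n : ℝ) + 1)) ≤ μ.real (armEvent n) := by
  have h1 : (1 : ℝ) / 2 ≤ μ.real (tbCrossing n n) := by
    have h := real_tbCrossing half n n
    rw [show bondPercolation (zdGraph 2) half = μ from rfl] at h
    rw [h]; exact half_le_crossingProb_self crossingProb_half_succ_self_holds n
  have h2 : μ.real (tbCrossing n n) ≤ ∑ j ∈ Finset.range (n + 1), μ.real (armEventAt (j : ℤ) n) :=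
    (measureReal_mono (tbCrossing_subset_iUnion n) (measure_ne_top μ _)).trans
      (measureReal_biUnion_finset_le _ _)
  have h3 : ∑ j ∈ Finset.range (n + 1), μ.real (armEventAt (j : ℤ) n) = ((n : ℝ) + 1) * μ.real (armEvent n) := by
    simp only [measureReal_armEventAt, Finset.sum_const, Finset.card_range, nsmul_eq_mul]
    push_cast; ring
  rw [h3] at h2
  rw [div_le_iff₀ (by positivity)]
  nlinarith [h1.trans h2]

/-- The marked vertex of the instance `x = 2` is `(2n,0)`. [folklore] -/
lemma pt_two (n : ℕ) : pt 2 n = bpt (2 * (n : ℤ)) := by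
  unfold pt bpt
  rw [show (2 : ℝ) * (n : ℝ) = ((2 * (n : ℤ) : ℤ) : ℝ) by push_cast; ring, Int.floor_intCast]

/-- At `x = c = 2` the crux's event is `{A_n ↔ (2n,0) in H}`. [folklore] -/
lemma markEvent_two (n : ℕ) : markEvent 0 1 2 2 n = openCrossing halfPlane (arcA 0 1 n) {bpt (2 * (n : ℤ))} := by
  have hC : arcC 2 2 n = ∅ := by
    ext v; simp only [arcC, mem_setOf_eq, mem_empty_iff_false, iff_false]; omega
  rw [markEvent, hC, openCrossing_empty_right, sdiff_empty, pt_two]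

/-- **Deterministic gluing**: a vertical crossing of `[0,n]²`, a horizontal crossing of
`[0,3n]×[0,n]` and an arm from `(2n,0)` to height `n` inside `[n,3n]×[0,n]` together join `(2n,0)`
to the bottom side `[0,n]×{0} = A_n` inside the half-plane (two applications of the
rectangle-crossing Jordan lemma). [folklore] -/
theorem glue_to_point {n : ℕ} {ω : BondConfig (Site 2)} (hω : ω ⊆ (zdGraph 2).edgeSet)
    (hV : ω ∈ tbCrossing n n) (hH : ω ∈ lrCrossing (3 * n) n) (hA : ω ∈ armEventAt (2 * (n : ℤ)) n) :
    ω ∈ openCrossing halfPlane (arcA 0 1 n) {bpt (2 * (n : ℤ))} := by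
  classical
  set Big : Set (Site 2) := ↑(rectangle (3 * n) n) with hBig
  have hmemBig : ∀ z : Site 2, z ∈ Big ↔ 0 ≤ z 0 ∧ z 0 ≤ 3 * (n : ℤ) ∧ 0 ≤ z 1 ∧ z 1 ≤ n := by
    intro z; rw [hBig, Finset.mem_coe, mem_rectangle_iff]; push_cast; exact Iff.rfl
  have hBigH : Big ⊆ halfPlane := fun z hz ↦ by rw [hmemBig] at hz; exact hz.2.2.1
  have hSqH : (↑(rectangle n n) : Set (Site 2)) ⊆ halfPlane := fun z hz ↦ by
    rw [Finset.mem_coe, mem_rectangle_iff] at hz; exact hz.2.2.1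
  have hArH : (· + vshift (2 * (n : ℤ)) n) '' (↑(rectangle (2 * n) n) : Set (Site 2)) ⊆ halfPlane := by
    intro z hz; rw [mem_image_add_rectangle] at hz; simp only [vshift_one] at hz; exact hz.2.2.1
  -- the horizontal crossing
  obtain ⟨x, hx, y, hy, hxy⟩ := hH
  simp only [Finset.mem_coe, leftSide, rightSide, Finset.mem_filter, mem_rectangle_iff] at hx hy
  push_cast at hx hy
  -- its part before the first visit to the column `n`, inside the square
  obtain ⟨z₁, hz₁0, hxz₁⟩ := exists_openConnIn_column hω (n : ℤ) (by rw [hx.2]; positivity)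
    (by rw [hy.2]; omega) hxy
  obtain ⟨P₁, hP₁S, hP₁ω⟩ := exists_walk_of_mem_openConnIn hω hxz₁
  have hP₁box : ∀ w ∈ P₁.support, (0 : ℤ) ≤ w 0 ∧ w 0 ≤ n ∧ 0 ≤ w 1 ∧ w 1 ≤ n := by
    intro w hw
    have h := hP₁S w hw
    rw [mem_inter_iff, hmemBig, mem_setOf_eq] at h
    omega
  -- the vertical crossing of the square, from `b₁ ∈ A_n`
  obtain ⟨b₁, hb₁, t₁, ht₁, hbt₁⟩ := hV
  simp only [Finset.mem_coe, bottomSide, topSide, Finset.mem_filter, mem_rectangle_iff] at hb₁ ht₁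
  obtain ⟨Q₁, hQ₁S, hQ₁ω⟩ := exists_walk_of_mem_openConnIn hω hbt₁
  have hQ₁box : ∀ w ∈ Q₁.support, (0 : ℤ) ≤ w 0 ∧ w 0 ≤ n ∧ 0 ≤ w 1 ∧ w 1 ≤ n := by
    intro w hw
    have h := hQ₁S w hw
    rw [Finset.mem_coe, mem_rectangle_iff] at h
    omega
  obtain ⟨w₁, hw₁P, hw₁Q⟩ := exists_mem_support_of_crossing (L := 0) (R := n) (B := 0) (T := n)
    P₁ Q₁ hP₁box hQ₁box hx.2 hz₁0 hb₁.2 ht₁.2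
  -- the part of the horizontal crossing after its last visit to the column `n`
  have hyx : ω ∈ openConnIn Big y x := by rw [openConnIn_comm]; exact hxy
  obtain ⟨z₂, hz₂0, hyz₂⟩ := exists_openConnIn_column_ge hω (n : ℤ) (by rw [hy.2]; omega)
    (by rw [hx.2]; positivity) hyx
  have hz₂y : ω ∈ openConnIn (Big ∩ {z | (n : ℤ) ≤ z 0}) z₂ y := by rw [openConnIn_comm]; exact hyz₂
  obtain ⟨P₂, hP₂S, hP₂ω⟩ := exists_walk_of_mem_openConnIn hω hz₂y
  have hP₂box : ∀ w ∈ P₂.support, (n : ℤ) ≤ w 0 ∧ w 0 ≤ 3 * n ∧ 0 ≤ w 1 ∧ w 1 ≤ n := by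
    intro w hw
    have h := hP₂S w hw
    rw [mem_inter_iff, hmemBig, mem_setOf_eq] at h
    omega
  -- the arm from `(2n,0)`
  obtain ⟨b₂, hb₂, t₂, ht₂, hbt₂⟩ := hA
  rw [image_vshift_singleton, mem_singleton_iff] at hb₂
  rw [mem_image_add_topSide] at ht₂
  simp only [vshift_zero, vshift_one, zero_add] at ht₂
  push_cast at ht₂
  obtain ⟨Q₂, hQ₂S, hQ₂ω⟩ := exists_walk_of_mem_openConnIn hω hbt₂
  have hQ₂box : ∀ w ∈ Q₂.support, (n : ℤ) ≤ w 0 ∧ w 0 ≤ 3 * n ∧ 0 ≤ w 1 ∧ w 1 ≤ n := by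
    intro w hw
    have h := hQ₂S w hw
    rw [mem_image_add_rectangle] at h
    simp only [vshift_zero, vshift_one] at h
    push_cast at h
    omega
  have hb₂1 : b₂ 1 = 0 := by rw [hb₂]; rfl
  obtain ⟨w₂, hw₂P, hw₂Q⟩ := exists_mem_support_of_crossing (L := (n : ℤ)) (R := 3 * n) (B := 0) (T := n)
    P₂ Q₂ hP₂box hQ₂box hz₂0 (by rw [hy.2]) hb₂1 ht₂.2
  -- assemble `b₁ ↔ w₁ ↔ x ↔ y ↔ z₂ ↔ w₂ ↔ b₂` inside the half-plane
  have c₁ : ω ∈ openConnIn halfPlane b₁ w₁ :=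
    openConnIn_mono hSqH _ _ (mem_openConnIn_of_mem_support Q₁ hQ₁S hQ₁ω hw₁Q)
  have c₂ : ω ∈ openConnIn halfPlane w₁ x := by
    rw [openConnIn_comm]
    exact openConnIn_mono (inter_subset_left.trans hBigH) _ _
      (mem_openConnIn_of_mem_support P₁ hP₁S hP₁ω hw₁P)
  have c₃ : ω ∈ openConnIn halfPlane x y := openConnIn_mono hBigH _ _ hxy
  have c₄ : ω ∈ openConnIn halfPlane y z₂ :=
    openConnIn_mono (inter_subset_left.trans hBigH) _ _ hyz₂
  have c₅ : ω ∈ openConnIn halfPlane z₂ w₂ :=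
    openConnIn_mono (inter_subset_left.trans hBigH) _ _
      (mem_openConnIn_of_mem_support P₂ hP₂S hP₂ω hw₂P)
  have c₆ : ω ∈ openConnIn halfPlane w₂ b₂ := by
    rw [openConnIn_comm]
    exact openConnIn_mono hArH _ _ (mem_openConnIn_of_mem_support Q₂ hQ₂S hQ₂ω hw₂Q)
  refine ⟨b₁, ?_, b₂, by rw [hb₂]; exact mem_singleton _, ?_⟩
  · simp only [arcA, zero_mul, Int.floor_zero, one_mul, Int.floor_natCast, mem_setOf_eq]
    exact ⟨hb₁.2, hb₁.1.1, hb₁.1.2.1⟩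
  · exact PlanarDuality.openConnIn_trans (PlanarDuality.openConnIn_trans
      (PlanarDuality.openConnIn_trans (PlanarDuality.openConnIn_trans
        (PlanarDuality.openConnIn_trans c₁ c₂) c₃) c₄) c₅) c₆

/-- **§7 main**: at `x = c` (instance `0,1,2`), `n·P[E_n] = n·P[A_n ↔ (2n,0) in ℤ×ℕ] ≥ c_RSW/8`
for all `n ≥ 1`. [folklore] -/
theorem first_site_heavy : ∃ κ : ℝ, 0 < κ ∧ ∀ n : ℕ, 1 ≤ n → κ ≤ (n : ℝ) * μ.real (markEvent 0 1 2 2 n) := by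
  obtain ⟨c, hc, hcross⟩ := rsw_lowerBound_holds 4 (by norm_num)
  refine ⟨c / 8, by positivity, fun n hn ↦ ?_⟩
  set V := tbCrossing n n with hVdef
  set Hc := lrCrossing (3 * n) n with hHcdef
  set Ar := armEventAt (2 * (n : ℤ)) n with hArdef
  have hV : 1 / 2 ≤ μ.real V := by
    have h := real_tbCrossing half n n
    rw [show bondPercolation (zdGraph 2) half = μ from rfl] at h
    rw [hVdef, h]; exact half_le_crossingProb_self crossingProb_half_succ_self_holds n
  have hHc : c ≤ μ.real Hc := by
    have h1 := hcross (n + 1) (by omega)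
    have h2 : crossingProb half (4 * (n + 1) - 1) (n + 1 - 1) ≤ crossingProb half (3 * n) n := by
      rw [show n + 1 - 1 = n by omega]; exact crossingProb_anti_left half (by omega) n
    exact h1.trans h2
  have hAr : 1 / (2 * ((n : ℝ) + 1)) ≤ μ.real Ar := by
    rw [hArdef, measureReal_armEventAt]; exact armEvent_prob_ge n
  have hupV : IsUpperSet V := isUpperSet_openCrossing _ _ _
  have hupH : IsUpperSet Hc := isUpperSet_openCrossing _ _ _
  have hupA : IsUpperSet Ar := isUpperSet_openCrossing _ _ _
  have hmV : MeasurableSet V := measurableSet_openCrossing_of_countable _ _ _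
  have hmH : MeasurableSet Hc := measurableSet_openCrossing_of_countable _ _ _
  have hmA : MeasurableSet Ar := measurableSet_openCrossing_of_countable _ _ _
  have hfkg1 : μ.real V * μ.real Hc ≤ μ.real (V ∩ Hc) :=
    harris_fkg_holds (zdGraph 2) half hupV hupH hmV hmH
  have hfkg2 : μ.real (V ∩ Hc) * μ.real Ar ≤ μ.real (V ∩ Hc ∩ Ar) :=
    harris_fkg_holds (zdGraph 2) half (hupV.inter hupH) hupA (hmV.inter hmH) hmA
  have hincl : μ.real (V ∩ Hc ∩ Ar) ≤ μ.real (markEvent 0 1 2 2 n) := by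
    rw [measureReal_def, measureReal_def]
    refine ENNReal.toReal_mono (measure_ne_top _ _) (measure_mono_ae ?_)
    filter_upwards [ae_subset_edgeSet (zdGraph 2) half] with ω hω
    rintro ⟨⟨h1, h2⟩, h3⟩
    rw [markEvent_two]
    exact glue_to_point hω h1 h2 h3
  have hV0 : 0 ≤ μ.real V := measureReal_nonneg
  have hA0 : 0 ≤ μ.real Ar := measureReal_nonneg
  have hprod : 1 / 2 * c * (1 / (2 * ((n : ℝ) + 1))) ≤ μ.real (markEvent 0 1 2 2 n) :=
    calc 1 / 2 * c * (1 / (2 * ((n : ℝ) + 1))) ≤ μ.real V * μ.real Hc * μ.real Ar := by gcongr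
      _ ≤ μ.real (V ∩ Hc) * μ.real Ar := by gcongr
      _ ≤ μ.real (V ∩ Hc ∩ Ar) := hfkg2
      _ ≤ μ.real (markEvent 0 1 2 2 n) := hincl
  have hn1 : (1 : ℝ) ≤ n := by exact_mod_cast hn
  calc c / 8 ≤ (n : ℝ) * (1 / 2 * c * (1 / (2 * ((n : ℝ) + 1)))) := by
        rw [show (n : ℝ) * (1 / 2 * c * (1 / (2 * ((n : ℝ) + 1)))) = c * n / (4 * (n + 1)) by
          field_simp; ring]
        rw [div_le_div_iff₀ (by norm_num) (by positivity)]
        nlinarith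
    _ ≤ (n : ℝ) * μ.real (markEvent 0 1 2 2 n) := by gcongr

/-- The claimed density at `x = c` is the junk value `0`. [folklore] -/
lemma density_x_eq_c (a b c : ℝ) : density a b c c = 0 := by
  simp [density, Real.zero_rpow]

/-- **Corollary**: the crux's conclusion fails at the boundary `x = c` (instance `0,1,2,2`):
`n·P[E_n] ≥ κ > 0` cannot tend to `density 0 1 2 2 = 0`. [folklore] -/
theorem not_lawAt_x_eq_c : ¬ Tendsto (lawSeq 0 1 2 2) atTop (𝓝 (density 0 1 2 2)) := by
  intro h
  obtain ⟨κ, hκ, hlow⟩ := first_site_heavy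
  rw [density_x_eq_c] at h
  have hev : ∀ᶠ n : ℕ in atTop, lawSeq 0 1 2 2 n < κ := h.eventually (gt_mem_nhds hκ)
  obtain ⟨N, hN1, hN2⟩ := ((eventually_ge_atTop 1).and hev).exists
  exact absurd (hlow N hN1) (not_le.2 hN2)

/-- The crux with `c < x` weakened to `c ≤ x` is false for a SUBSTANTIVE reason (§7), not only
through the junk witness of §4. [folklore] -/
theorem law_false_with_hcx_le :
    ¬ ∀ a b c x : ℝ, a < b → b < c → c ≤ x → Tendsto (lawSeq a b c x) atTop (𝓝 (density a b c x)) :=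
  fun h ↦ not_lawAt_x_eq_c (h 0 1 2 2 (by norm_num) (by norm_num) le_rfl)

end Summit.CriticalPhenomena.CardyFormulaZ2.Theorems.HalfPlaneMarkDensityLaw.Negative
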